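/-
Origin: expansion seat `planner-pub-hodgecm-pv03-g8-0`, handover #2 2026-08-18T14:18:50Z (md5 ccdf9fee) (`HOME/pub-hodgecm-pv03-g8/lean/Pv03g8/CMInflation3.lean`, md5 ccdf9fee, 118 lines);
landed by the gen-8 packager in gate run 30 as `HodgeCM/Model/ToyG2/CMInflation3.lean` (verbatim).
-/
/-
Copyright: pub-hodgecm cell (HodgeCMPerL). Consistency-witness layer (part (e)); FACTS.md §1c row M38, universe of record.
Origin: HOME/pub-hodgecm-pv03-g8/lean/Pv03g8/CMInflation3.lean (WIP module `Pv03g8.CMInflation3`; intended final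
place `HodgeCM/Model/ToyG2/CMInflation3.lean` = module `HodgeCM.Model.ToyG2.CMInflation3`, CONTRIBUTING §3 kind L5)
(seat planner-pub-hodgecm-pv03-g8-0, DAG-node prover #03 gen 8; census of the end-state binders in the universe of record).
WIP imports to rewrite on landing: none (tree names only).
-/
import Mathlib
import Summits.HodgeConjecture.HodgeCM.Model.ToyG2.OpenInputsAll3
import Summits.HodgeConjecture.HodgeCM.Model.ToyG2.G4WitnessCM
import Summits.HodgeConjecture.HodgeCM.Model.ToyG2.DescentFactsAll3
import Summits.HodgeConjecture.HodgeCM.Model.Toy.CMInflation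

/-!
# M38 `Fact_cmInflation` holds in the universe of record `toyUniverse₃ d t` (and in `toyUniverseCM d t`)

The class-M model fact M38 `HodgeCM.Universe.Fact_cmInflation` (`PerL34/ThetaSubOfLiu.lean` :158; binder `hM38` of the
end state `PerL34.EndStateShadow.EndState`, and of `Universe.ThetaModel.open_thetaSub_of_liu`) says: for CM fields `k : K → M` and a
CM type `Φ` of `K` there are morphisms `p_j : A_{(M, Φ^M)} → A_{(K, Φ)}` with `⊕_j p_j^* : H¹(A_{(K,Φ)})^m ≅ H¹(A_{(M,Φ^M)})`
`K`-equivariantly (`A_{(M,Φ^M)} ∼ A_{(K,Φ)}^{[M:K]}`, Shimura 1998 §6).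

pv04 proved it in the generation-1 exterior toy universe (`HodgeCM.Toy.fact_cmInflation`, `Model/Toy/CMInflation.lean`,
for every `HodgeData D`) and pv04-g6 that it is INDEPENDENT of every numbered §1c fact there
(`Toy.cmInflation_independent_all`).  It had not been decided in the generation-2/3 universe OF RECORD
`toyUniverse₃ d t = toyModel3With exteriorHodgeData traceSys (gplOf d t)` (toy-g2/g3), the universe carrying
`ModelAxioms ∧ OpenInputs ∧ PerL ∧ HC_CM ∧ RealisationExistsPerL ∧ RealisationExistsFace` (`toyUniverse₃_profile_all`).

This file decides it, positively, by the same one-line transport as M25 `fact3_conjIsogeny` (`Universe3.lean` :203):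
the reference CM objects `cmAV K Φ = cmObj₂ K Φ` of the generation-3 universe are BLOCK-FREE (`isBlockFree_cmObj₂`), so
every generation-1 morphism into them is a generation-3 morphism (`Hom₂.ofHom`), with the same `H¹`-pull-back and the
same CM action definitionally.

* `fact3_cmInflation D T pl : (toyModel3With D T pl).Fact_cmInflation` — for EVERY Hodge data, trace system and block
  assignment (M38 mentions neither the trace nor the Picard objects);
* `toyUniverse₃_fact_cmInflation d t`, and `toyUniverseCM_fact_cmInflation d t` for pv03-g6's CM-good full
  sub-universe (`Universe.restrictObj_fact_cmInflation`: `cmAV`, `Mor`, `pull`, `cmAct` of `restrictObj` are those of `U`);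
* `toyUniverse₃_profile_cmInflation`: for `1 ≤ d`, `t² = 16` the universe of record satisfies
  `ModelAxioms ∧ OpenInputs ∧ PerL ∧ HC_CM ∧ RealisationExistsPerL ∧ RealisationExistsFace ∧ Fact_cmInflation`;
  `exists_model_profile_cmInflation` packages the witness `toyUniverse₃ 1 4`;
* `toyUniverse₃_endToEnd_universeLevel`: EVERY UNIVERSE-LEVEL binder of the end-to-end theorem of record
  `PerL34.EndStateSignRecipe.hcCM_of_openCharsWeilLeavesCRΔ_signRecipe_descentFactsB₄` (`PerL34/EndStateMinimal.lean`) (`M` + 12 + 7) EXCEPT `h07` holds in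
  the universe of record: `M` (toy-g3), the seven [QW8]-side facts N1, N2, F4, F5, F-H0, F7d-B, M40 (pv03-g6
  `toyUniverse₃_descentFactsB₄_all`) and M38 (this file); `h07` = N07 is refuted there (toy-g5 / pv03-g8 `NoEndState3`),
  and the remaining ten binders are statements about a theta model `T` over the universe, not about the universe.

Reading.  Of the four fact-level binders of the end states over re-signed models (N07, N09a, N09b print; M38 class M),
M38 is hereby WITNESSED in the universe of record jointly with the whole `toyUniverse₃` profile; N07 is REFUTED there
(toy-g5 `HodgeRiemann3`, pv03-g8 `NoEndState3`); N09a / N09b are statements about a theta MODEL `T` and are not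
universe-level.  Nothing here is about abelian varieties over `ℂ`; it is a consistency statement about the package's
hypothesis list.  Everything is kernel-proved from the tree; no citation, nothing posited.
-/

noncomputable section

namespace HodgeCM

namespace Universe

variable {U : Universe} {Q : U.Var → Prop} (hQ : U.SubClosed Q)

/-- M38 transfers to any full sub-universe on a constructor-closed class of objects (all data `rfl`). -/
theorem restrictObj_fact_cmInflation (h : U.Fact_cmInflation) : (U.restrictObj Q hQ).Fact_cmInflation :=
  fun K M k Φ => h K M k Φ

end Universe

namespace ToyG2

open HodgeCM.Toy Obj₂ HodgeCM.Universe

/-- **M38 holds in every generation-3 toy universe** `toyModel3With D T pl`: transport of pv04's generation-1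
`Toy.fact_cmInflation D` along `Hom₂.ofHom` into the block-free reference CM objects. -/
theorem fact3_cmInflation (D : HodgeData) (T : TraceSys) (pl : GBlocks) :
    (toyModel3With D T pl).Fact_cmInflation := by
  intro K M k Φ
  obtain ⟨m, p, hp, hp'⟩ := HodgeCM.Toy.fact_cmInflation D K M k Φ
  exact ⟨m, fun j => Hom₂.ofHom (p j) (isBlockFree_cmObj₂ K Φ), hp, hp'⟩

/-- **M38 holds in the universe of record** `toyUniverse₃ d t` (every `d t`). -/
theorem toyUniverse₃_fact_cmInflation (d t : ℚ) : (toyUniverse₃ d t).Fact_cmInflation :=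
  fact3_cmInflation _ _ _

/-- **M38 holds in the CM-good universe** `toyUniverseCM d t` (pv03-g6 `G4WitnessCM`). -/
theorem toyUniverseCM_fact_cmInflation (d t : ℚ) : (toyUniverseCM d t).Fact_cmInflation :=
  restrictObj_fact_cmInflation _ (toyUniverse₃_fact_cmInflation d t)

/-- **The profile of the universe of record, extended by M38**: for `1 ≤ d`, `t² = 16`,
`ModelAxioms ∧ OpenInputs ∧ PerL ∧ HC_CM ∧ RealisationExistsPerL ∧ RealisationExistsFace ∧ Fact_cmInflation`. -/
theorem toyUniverse₃_profile_cmInflation (d t : ℚ) (hd : (1 : ℚ) ≤ d) (ht : t ^ 2 = 16) :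
    (toyUniverse₃ d t).ModelAxioms ∧ (toyUniverse₃ d t).OpenInputs ∧ (toyUniverse₃ d t).PerL ∧
      (toyUniverse₃ d t).HC_CM ∧ (toyUniverse₃ d t).RealisationExistsPerL ∧
      (toyUniverse₃ d t).RealisationExistsFace ∧ (toyUniverse₃ d t).Fact_cmInflation := by
  obtain ⟨hM, hO, ⟨hRP, hRF, -⟩, hHC, hPerL, -⟩ := toyUniverse₃_profile_all d t hd ht
  exact ⟨hM, hO, hPerL, hHC, hRP, hRF, toyUniverse₃_fact_cmInflation d t⟩

/-- **Universe-level binders of the end-to-end theorem of record, in the universe of record**: the model axioms `M`,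
the seven [QW8]-side facts of route (δ) — N1 `Fact_cupExterior`, N2 `Fact_cup_hodge`, F4 `Fact_cupAlg`, F5 `Fact_cupAssoc`,
F-H0 `Fact_unitH0`, F7d-B `Fact_gysinDescentB`, M40 `Fact_dimProd` (pv03-g6 `toyUniverse₃_descentFactsB₄_all`) — and M38
`Fact_cmInflation` ALL hold in `toyUniverse₃ d t` (`1 ≤ d`, `t² = 16`); of the universe-level binders of
`PerL34.EndStateSignRecipe.hcCM_of_openCharsWeilLeavesCRΔ_signRecipe_descentFactsB₄` (`PerL34/EndStateMinimal.lean`) only `h07` (N07) fails there. -/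
theorem toyUniverse₃_endToEnd_universeLevel (d t : ℚ) (hd : (1 : ℚ) ≤ d) (ht : t ^ 2 = 16) :
    (toyUniverse₃ d t).ModelAxioms ∧ (toyUniverse₃ d t).Fact_cupExterior ∧ (toyUniverse₃ d t).Fact_cup_hodge ∧
      (toyUniverse₃ d t).Fact_cupAlg ∧ (toyUniverse₃ d t).Fact_cupAssoc ∧ (toyUniverse₃ d t).Fact_unitH0 ∧
      (toyUniverse₃ d t).Fact_gysinDescentB ∧ (toyUniverse₃ d t).Fact_dimProd ∧ (toyUniverse₃ d t).Fact_cmInflation := by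
  obtain ⟨hM, -, h1, h2, h4, h5, hu, hb, hdp⟩ := toyUniverse₃_descentFactsB₄_all d t hd ht
  exact ⟨hM, h1, h2, h4, h5, hu, hb, hdp, toyUniverse₃_fact_cmInflation d t⟩

/-- **M38 is jointly consistent with the whole profile of the universe of record** (witness `toyUniverse₃ 1 4`). -/
theorem exists_model_profile_cmInflation :
    ∃ U : Universe, U.ModelAxioms ∧ U.OpenInputs ∧ U.PerL ∧ U.HC_CM ∧ U.RealisationExistsPerL ∧
      U.RealisationExistsFace ∧ U.Fact_cmInflation :=
  ⟨toyUniverse₃ 1 4, toyUniverse₃_profile_cmInflation 1 4 le_rfl (by norm_num)⟩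

end ToyG2

end HodgeCM

end
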